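import Summits.Schanuel.Schanuel.Theorems.ZilberEacPowerCurveConstFibre
import HarnessLib

/-!
# Arbitrary base branches, XXI: constant fibres over EVERY Weierstrass cubic
# `x₁² = x₀³ + a x₀² + b x₀ + c` are in Mantova–Masser's case AND dense

HONEST FRAMING.  Cell `pub-schanuel` (Zilber's Exponential-Algebraic Closedness, case ladder;
host summit Schanuel), seat 2, gen 28.  For all `a, b, c ∈ ℂ` the plane cubic
`E : x₁² = x₀³ + a x₀² + b x₀ + c` (every elliptic curve in Weierstrass form, and the nodal and
cuspidal cubics) is irreducible (a cubic is not a square), has ONE place at infinity with the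
ramified branch `x₀ = s^{-2}`, `x₁ = (1 + a s² + b s⁴ + c s⁶)^{1/2}s^{-3}` — label order `k = 2`,
second order `M = 3`, direction `1` — and `(k, M) = (2, 3)` is off the residue class of file XX
(`2M/k = 3 ≢ 2 mod 4`).  So by files XIX/XX (one good square root of `2πi` suffices, and one
exists), for every `θ ≠ 0` the constant-fibre cylinder `{x₁² = x₀³ + a x₀² + b x₀ + c, y₀ = θ}
⊆ ℂ² × ℂ²` has Zariski-dense exponential points, and it is in Mantova–Masser's case
(dim-π-S-1-free: if all points of `E` were on a line `m₀x₀ + m₁x₁ = c₀`, the involution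
`x₁ ↦ −x₁` would force the cubic to vanish identically):
**`unprojectedDensityQuestion_weierstrass_constFibre`** — a THREE-parameter family of decided
instances over genus-one (and singular rational) bases.  Decided instances of an OPEN question
(Mantova–Masser, PLMS 2024 §1 p. 5); EC(3,2) OPEN; NOT Schanuel's conjecture (neither used nor
implied); EAC ⇏ SC.
-/

noncomputable section

open Filter Topology Set Complex MvPolynomial
open Literature.NumberTheory.Transcendental Literature.ModelTheory.Zilber
open Literature.ModelTheory.ExponentialFields

set_option linter.dupNamespace false

namespace Summit.Schanuel.Schanuel.Theorems

/-! ## Part A. The Weierstrass cubic relation is irreducible (a cubic is not a square) -/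

/-- `t² − (s³ + a s² + b s + c)` is irreducible in `ℂ[s][t]` for ALL `a, b, c`: a monic quadratic
in `t` with zero linear term factors only if its constant term is minus a square, and a cubic in
`s` is not a square. [folklore] -/
theorem irreducible_weierstrass_row (a b c : ℂ) :
    Irreducible (Polynomial.X ^ 2 + Polynomial.C (-(Polynomial.X ^ 3 +
      Polynomial.C a * Polynomial.X ^ 2 + Polynomial.C b * Polynomial.X + Polynomial.C c) :
        Polynomial ℂ)) := by
  set P : Polynomial ℂ := Polynomial.X ^ 3 + Polynomial.C a * Polynomial.X ^ 2 +
    Polynomial.C b * Polynomial.X + Polynomial.C c with hP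
  have hPdeg : P.natDegree = 3 := by
    rw [hP]
    compute_degree!
  have hmonic : (Polynomial.X ^ 2 + Polynomial.C (-P)).Monic :=
    Polynomial.monic_X_pow_add_C _ (by norm_num)
  have hdeg : (Polynomial.X ^ 2 + Polynomial.C (-P)).natDegree = 2 :=
    Polynomial.natDegree_X_pow_add_C
  by_contra hirr
  obtain ⟨c₁, c₂, hmul, hadd⟩ :=
    (hmonic.not_irreducible_iff_exists_add_mul_eq_coeff hdeg).1 hirr
  rw [Polynomial.coeff_add, Polynomial.coeff_X_pow, if_neg (by norm_num), zero_add,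
    Polynomial.coeff_C_zero] at hmul
  rw [Polynomial.coeff_add, Polynomial.coeff_X_pow, if_neg (by norm_num), zero_add,
    Polynomial.coeff_C, if_neg (by norm_num)] at hadd
  have hc₂ : c₂ = -c₁ := by linear_combination -hadd
  rw [hc₂] at hmul
  have hPsq : P = c₁ ^ 2 := by linear_combination -hmul
  have h3 := congrArg Polynomial.natDegree hPsq
  rw [hPdeg, Polynomial.natDegree_pow] at h3
  omega

/-- Evaluation of the Weierstrass relation `x₁² − (x₀³ + a x₀² + b x₀ + c)`. -/
theorem eval_weierstrassMv (a b c : ℂ) (x : Fin 2 → ℂ) :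
    MvPolynomial.eval x (X 1 ^ 2 - (X 0 ^ 3 + MvPolynomial.C a * X 0 ^ 2 +
      MvPolynomial.C b * X 0 + MvPolynomial.C c) : MvPolynomial (Fin 2) ℂ) =
      x 1 ^ 2 - (x 0 ^ 3 + a * x 0 ^ 2 + b * x 0 + c) := by
  simp

/-- The Weierstrass relation and its rows. -/
theorem eval_weierstrassMv_rows (a b c : ℂ) (x y : ℂ) :
    MvPolynomial.eval ![x, y] (X 1 ^ 2 - (X 0 ^ 3 + MvPolynomial.C a * X 0 ^ 2 +
      MvPolynomial.C b * X 0 + MvPolynomial.C c) : MvPolynomial (Fin 2) ℂ) =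
      ((Polynomial.X ^ 2 + Polynomial.C (-(Polynomial.X ^ 3 +
        Polynomial.C a * Polynomial.X ^ 2 + Polynomial.C b * Polynomial.X + Polynomial.C c) :
          Polynomial ℂ)).map (Polynomial.evalRingHom x)).eval y := by
  rw [eval_weierstrassMv]
  simp
  ring

/-- The Weierstrass relation is irreducible in `ℂ[x₀, x₁]`, for all `a, b, c`. [folklore] -/
theorem irreducible_weierstrassMv (a b c : ℂ) :
    Irreducible (X 1 ^ 2 - (X 0 ^ 3 + MvPolynomial.C a * X 0 ^ 2 +
      MvPolynomial.C b * X 0 + MvPolynomial.C c) : MvPolynomial (Fin 2) ℂ) :=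
  (irreducible_rows_iff (eval_weierstrassMv_rows a b c)).2 (irreducible_weierstrass_row a b c)

/-! ## Part B. The branch at infinity (`k = 2`, `M = 3`) and density -/

/-- **Constant fibres over every Weierstrass cubic are dense** (`θ ≠ 0`): the branch at infinity
`x₀ = s^{-2}`, `x₁ = (1 + a s² + b s⁴ + c s⁶)^{1/2}s^{-3}` has `(k, M) = (2, 3)` and direction `1`;
a square root `z` of `2πi` with `Re z³ ≠ 0` exists (file XX), and one good direction suffices
(file XIX). [cite: MantovaMasser2023, §1 Further remarks, p. 5 (the question, open in general)]
(new) -/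
theorem unprojectedDense_weierstrass_constFibre (a b c : ℂ) {θ : ℂ} (hθ : θ ≠ 0) :
    UnprojectedDense {w : Fin 2 ⊕ Fin 2 → ℂ |
      MvPolynomial.eval ![w (Sum.inl 0), w (Sum.inl 1)]
          (X 1 ^ 2 - (X 0 ^ 3 + MvPolynomial.C a * X 0 ^ 2 +
            MvPolynomial.C b * X 0 + MvPolynomial.C c) : MvPolynomial (Fin 2) ℂ) = 0 ∧
      w (Sum.inr 0) = MvPolynomial.eval ![w (Sum.inl 0), w (Sum.inl 1)]
        (MvPolynomial.C θ : MvPolynomial (Fin 2) ℂ)} := by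
  have hS := isIrreducibleClosed_curveGraphFibre (MvPolynomial.C θ : MvPolynomial (Fin 2) ℂ)
    (irreducible_weierstrassMv a b c)
  have hdim := zariskiDim_curveGraphFibre (MvPolynomial.C θ : MvPolynomial (Fin 2) ℂ)
    (irreducible_weierstrassMv a b c)
  obtain ⟨q, hqan, hq0, hq2⟩ := kthRoot_branch_facts (k := 2) (by norm_num)
  -- `x₀ = s^{-2}`, `x₁ = q(a s² + b s⁴ + c s⁶) s^{-3}`, `y₀ = θ`
  set v : ℂ → ℂ := fun s => a * s ^ 2 + b * s ^ 4 + c * s ^ 6 with hv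
  have hvan : AnalyticAt ℂ v 0 :=
    ((analyticAt_const.mul (analyticAt_id.pow 2)).add
      (analyticAt_const.mul (analyticAt_id.pow 4))).add
      (analyticAt_const.mul (analyticAt_id.pow 6))
  have hv0 : v 0 = 0 := by simp [hv]
  set Φ : ℂ → ℂ := fun s => q (v s) with hΦ
  have hΦan : AnalyticAt ℂ Φ 0 := hqan.comp_of_eq hvan hv0
  have hΦ0 : Φ 0 = 1 := by simp [hΦ, hv0, hq0]
  have hψan : AnalyticAt ℂ (fun _ : ℂ => θ) 0 := analyticAt_const
  have hq2' : ∀ᶠ s in 𝓝 (0 : ℂ), q (v s) ^ 2 = 1 + v s := by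
    have h := hvan.continuousAt.tendsto
    rw [hv0] at h
    exact h.eventually hq2
  have hgerm : ∀ᶠ s in 𝓝[≠] (0 : ℂ),
      (Sum.elim ![(s ^ 2)⁻¹, Φ s * (s ^ 3)⁻¹]
          ![(fun _ : ℂ => θ) s, Complex.exp (Φ s * (s ^ 3)⁻¹)] : Fin 2 ⊕ Fin 2 → ℂ) ∈
        {w : Fin 2 ⊕ Fin 2 → ℂ |
          MvPolynomial.eval ![w (Sum.inl 0), w (Sum.inl 1)]
              (X 1 ^ 2 - (X 0 ^ 3 + MvPolynomial.C a * X 0 ^ 2 +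
                MvPolynomial.C b * X 0 + MvPolynomial.C c) : MvPolynomial (Fin 2) ℂ) = 0 ∧
          w (Sum.inr 0) = MvPolynomial.eval ![w (Sum.inl 0), w (Sum.inl 1)]
            (MvPolynomial.C θ : MvPolynomial (Fin 2) ℂ)} := by
    filter_upwards [self_mem_nhdsWithin, nhdsWithin_le_nhds hq2'] with s (hs : s ≠ 0) hqs
    refine ⟨?_, ?_⟩
    · simp only [Sum.elim_inl, Matrix.cons_val_zero, Matrix.cons_val_one]
      rw [eval_weierstrassMv]
      simp only [Matrix.cons_val_zero, Matrix.cons_val_one, hΦ]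
      rw [mul_pow, hqs, hv]
      field_simp
      ring
    · simp only [Sum.elim_inr, Matrix.cons_val_zero, MvPolynomial.eval_C]
  obtain ⟨z, hz, hzre⟩ := exists_direction_powerCurve (k := 2) (M := 3) (by norm_num) (by decide)
  exact unprojectedDense_branch_growth_of_exists_direction hS (le_of_eq hdim) (by norm_num : 1 ≤ 2)
    (by norm_num : 1 ≤ 3) hψan hθ rfl hΦan ⟨z, hz, by rw [hΦ0, one_mul]; exact hzre⟩ hgerm

/-! ## Part C. The case certificate, and case ∧ dense -/

/-- **The constant-fibre cylinder over every Weierstrass cubic is in Mantova–Masser's case**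
(`θ ≠ 0`): were all points of the cubic on a line `m₀x₀ + m₁x₁ = c₀`, either `m₁ = 0` (and the
points over `x₀ = 0, 1` give `m₀ = 0`) or the involution `x₁ ↦ −x₁` gives `x₁ = 0` on the curve,
i.e. the cubic vanishes identically. (new) -/
theorem mmCase_weierstrass_constFibre (a b c : ℂ) {θ : ℂ} (hθ : θ ≠ 0) :
    MMCaseDimPiOneFree {w : Fin 2 ⊕ Fin 2 → ℂ |
      MvPolynomial.eval ![w (Sum.inl 0), w (Sum.inl 1)]
          (X 1 ^ 2 - (X 0 ^ 3 + MvPolynomial.C a * X 0 ^ 2 +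
            MvPolynomial.C b * X 0 + MvPolynomial.C c) : MvPolynomial (Fin 2) ℂ) = 0 ∧
      w (Sum.inr 0) = MvPolynomial.eval ![w (Sum.inl 0), w (Sum.inl 1)]
        (MvPolynomial.C θ : MvPolynomial (Fin 2) ℂ)} := by
  refine mmCase_curveGraphFibre (irreducible_weierstrassMv a b c) ?_ ?_
  · obtain ⟨y, hy⟩ := IsAlgClosed.exists_pow_nat_eq c (by norm_num : 0 < 2)
    exact ⟨![0, y], by rw [eval_weierstrassMv]; simp [hy], by rw [MvPolynomial.eval_C]; exact hθ⟩
  · intro m hm c₀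
    by_contra hall
    push Not at hall
    have hpt : ∀ x y : ℂ, y ^ 2 = x ^ 3 + a * x ^ 2 + b * x + c →
        (m 0 : ℂ) * x + (m 1 : ℂ) * y = c₀ := by
      intro x y hy
      have := hall ![x, y] (by rw [eval_weierstrassMv]; simp [hy])
      simpa using this
    by_cases hm1 : (m 1 : ℂ) = 0
    · -- `m₁ = 0`: the points over `x₀ = 0` and `x₀ = 1` give `m₀ = 0`
      have hm0 : (m 0 : ℂ) ≠ 0 := by
        intro h0
        apply hm
        funext i
        fin_cases i
        · exact_mod_cast h0
        · exact_mod_cast hm1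
      obtain ⟨y₀, hy₀⟩ := IsAlgClosed.exists_pow_nat_eq (c : ℂ) (by norm_num : 0 < 2)
      obtain ⟨y₁, hy₁⟩ := IsAlgClosed.exists_pow_nat_eq (1 + a + b + c : ℂ) (by norm_num : 0 < 2)
      have h0 := hpt 0 y₀ (by rw [hy₀]; ring)
      have h1 := hpt 1 y₁ (by rw [hy₁]; ring)
      rw [hm1] at h0 h1
      apply hm0
      linear_combination h1 - h0
    · -- `m₁ ≠ 0`: the involution forces the cubic to vanish identically
      have hzero : ∀ x : ℂ, x ^ 3 + a * x ^ 2 + b * x + c = 0 := by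
        intro x
        obtain ⟨y, hy⟩ :=
          IsAlgClosed.exists_pow_nat_eq (x ^ 3 + a * x ^ 2 + b * x + c) (by norm_num : 0 < 2)
        have hyp := hpt x y hy
        have hyn := hpt x (-y) (by rw [neg_sq]; exact hy)
        have hy0 : y = 0 := by
          have h2 : (m 1 : ℂ) * (2 * y) = 0 := by linear_combination hyp - hyn
          rcases mul_eq_zero.1 h2 with h | h
          · exact absurd h hm1
          · simpa using h
        rw [← hy, hy0]
        norm_num
      have hP : (Polynomial.X ^ 3 + Polynomial.C a * Polynomial.X ^ 2 +
          Polynomial.C b * Polynomial.X + Polynomial.C c : Polynomial ℂ) = 0 := by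
        apply Polynomial.funext
        intro x
        simp [hzero x]
      have hPdeg : (Polynomial.X ^ 3 + Polynomial.C a * Polynomial.X ^ 2 +
          Polynomial.C b * Polynomial.X + Polynomial.C c : Polynomial ℂ).natDegree = 3 := by
        compute_degree!
      rw [hP, Polynomial.natDegree_zero] at hPdeg
      exact absurd hPdeg (by norm_num)

/-- **Mantova–Masser's question for constant fibres over every Weierstrass cubic: case ∧ dense**
(all `a, b, c`; `θ ≠ 0`). [cite: MantovaMasser2023, §1 Further remarks, p. 5 (the question, open
in general)] (new) -/
theorem unprojectedDensityQuestion_weierstrass_constFibre (a b c : ℂ) {θ : ℂ} (hθ : θ ≠ 0) :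
    MMCaseDimPiOneFree {w : Fin 2 ⊕ Fin 2 → ℂ |
        MvPolynomial.eval ![w (Sum.inl 0), w (Sum.inl 1)]
            (X 1 ^ 2 - (X 0 ^ 3 + MvPolynomial.C a * X 0 ^ 2 +
              MvPolynomial.C b * X 0 + MvPolynomial.C c) : MvPolynomial (Fin 2) ℂ) = 0 ∧
        w (Sum.inr 0) = MvPolynomial.eval ![w (Sum.inl 0), w (Sum.inl 1)]
          (MvPolynomial.C θ : MvPolynomial (Fin 2) ℂ)} ∧
      UnprojectedDense {w : Fin 2 ⊕ Fin 2 → ℂ |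
        MvPolynomial.eval ![w (Sum.inl 0), w (Sum.inl 1)]
            (X 1 ^ 2 - (X 0 ^ 3 + MvPolynomial.C a * X 0 ^ 2 +
              MvPolynomial.C b * X 0 + MvPolynomial.C c) : MvPolynomial (Fin 2) ℂ) = 0 ∧
        w (Sum.inr 0) = MvPolynomial.eval ![w (Sum.inl 0), w (Sum.inl 1)]
          (MvPolynomial.C θ : MvPolynomial (Fin 2) ℂ)} :=
  ⟨mmCase_weierstrass_constFibre a b c hθ, unprojectedDense_weierstrass_constFibre a b c hθ⟩

/-- **Plain coordinates**: `{x₁² − (x₀³ + a x₀² + b x₀ + c) = 0, y₀ = θ}` (`θ ≠ 0`) is in the case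
AND dense, for all `a, b, c`. [cite: MantovaMasser2023, §1 Further remarks, p. 5 (the question,
open in general)] (new) -/
theorem unprojectedDensityQuestion_weierstrass_constFibre' (a b c : ℂ) {θ : ℂ} (hθ : θ ≠ 0) :
    MMCaseDimPiOneFree {w : Fin 2 ⊕ Fin 2 → ℂ |
        w (Sum.inl 1) ^ 2 - (w (Sum.inl 0) ^ 3 + a * w (Sum.inl 0) ^ 2 + b * w (Sum.inl 0) + c) = 0 ∧
          w (Sum.inr 0) = θ} ∧
      UnprojectedDense {w : Fin 2 ⊕ Fin 2 → ℂ |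
        w (Sum.inl 1) ^ 2 - (w (Sum.inl 0) ^ 3 + a * w (Sum.inl 0) ^ 2 + b * w (Sum.inl 0) + c) = 0 ∧
          w (Sum.inr 0) = θ} := by
  have e : {w : Fin 2 ⊕ Fin 2 → ℂ |
        MvPolynomial.eval ![w (Sum.inl 0), w (Sum.inl 1)]
            (X 1 ^ 2 - (X 0 ^ 3 + MvPolynomial.C a * X 0 ^ 2 +
              MvPolynomial.C b * X 0 + MvPolynomial.C c) : MvPolynomial (Fin 2) ℂ) = 0 ∧
        w (Sum.inr 0) = MvPolynomial.eval ![w (Sum.inl 0), w (Sum.inl 1)]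
          (MvPolynomial.C θ : MvPolynomial (Fin 2) ℂ)} =
      {w : Fin 2 ⊕ Fin 2 → ℂ |
        w (Sum.inl 1) ^ 2 - (w (Sum.inl 0) ^ 3 + a * w (Sum.inl 0) ^ 2 + b * w (Sum.inl 0) + c) = 0 ∧
          w (Sum.inr 0) = θ} := by
    ext w
    simp only [Set.mem_setOf_eq, eval_weierstrassMv, MvPolynomial.eval_C, Matrix.cons_val_zero,
      Matrix.cons_val_one]
  have h := unprojectedDensityQuestion_weierstrass_constFibre a b c hθ
  rw [e] at h
  exact h

end Summit.Schanuel.Schanuel.Theorems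

end
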